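import Mathlib.Algebra.BigOperators.Group.Finset.Piecewise
import Mathlib.Algebra.Group.Nat.Even
import Mathlib.Combinatorics.SimpleGraph.Clique
import Mathlib.Data.Fin.Tuple.Basic
import Mathlib.Data.Fintype.Fin
import Mathlib.Data.Fintype.Pi
import Mathlib.InformationTheory.Hamming
import HarnessLib

/-!
# The code-size function `A(n,d)` of unrestricted binary codes

`A(n,d)` is the largest number of words of `{0,1}^n` that are pairwise at Hamming distance at
least `d` ("the central problem in combinatorial coding theory", van Lint 1992, §5.1). In graph
language (Laurent 2006, §1, p. 240): let `G(n,d)` be the graph on `{0,1}^n` in which two distinct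
words are adjacent iff their Hamming distance is `< d` (equivalently `∈ {1,…,d-1}`); the codes of
minimum distance `≥ d` are exactly the independent (stable) sets of `G(n,d)`, and `A(n,d)` is its
independence number.

* `hammingConflictGraph n d : SimpleGraph (Fin n → Bool)` — the graph `G(n,d)`, literally
  `SimpleGraph.fromRel fun u v => hammingDist u v < d` (the term inlined by the items of route
  PneNP/DelsarteLasserre, so `maxCodeSize_def` bridges to them by `rfl`);
* `maxCodeSize n d : ℕ := (hammingConflictGraph n d).indepNum` — `A(n,d)`;
* `parityBit`, `parityExtend` — the overall parity check and the extended word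
  (van Lint Def. 3.2.7), used for Theorem 5.1.3.

API (all elementary and classical): the bridge to finsets of words pairwise at distance `≥ d`
(`card_le_maxCodeSize`, `exists_code_card_eq_maxCodeSize`, and `isGreatest_maxCodeSize` = van
Lint's Definition 5.1.1 verbatim); `1 ≤ A(n,d) ≤ 2^n`; `A(n,0) = A(n,1) = 2^n`; `A(n,d) = 1` for
`d > n`; antitonicity in `d`; the transfer lemma `maxCodeSize_le_of_map`; puncturing
`A(n+1,d+1) ≤ A(n,d)` (`d ≥ 1`); extending by a parity bit `A(n,d) ≤ A(n+1,d+1)` (`d` odd); hence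
van Lint's Theorem 5.1.3 `A(n+1,d+1) = A(n,d)` for odd `d`, and `A(n+1,2) = 2^n`; shortening
`A(n+1,d) ≤ 2·A(n,d)`; the Singleton bound `A(n,d) ≤ 2^(n+1-d)` (Theorem 5.2.1); `A(n,n) = 2`.

Conventions. "Minimum distance at least `d`" (Laurent; MacWilliams–Sloane) rather than "exactly
`d`" (van Lint's `(n,M,d)` notation): the two maxima agree whenever `A(n,d) ≥ 2`, and the
"at least" version is the one that is an independence number and is antitone in `d`. `d = 0` is
allowed (`A(n,0) = 2^n`). Binary alphabet and index type `Fin n` only: every requester (route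
PneNP/DelsarteLasserre; the idea cards on `A(n,d)`) is binary with words `Fin n → Bool`; the
`q`-ary function `A_q(n,d)` is deliberately not here.

Not here (follow-ups): the Hamming (sphere-packing) and Plotkin bounds (van Lint Thms 5.2.7,
5.2.4), Delsarte's linear-programming bound and Schrijver's theorem `ϑ'(G(n,d)) =` Delsarte bound
(Schrijver 1979), tables of small values.

Mathlib has `hammingDist`, `SimpleGraph.indepNum`, `IsIndepSet.card_le_indepNum`,
`exists_isNIndepSet_indepNum`, but no notion of unrestricted code or of `A(n,d)` (searched:
`maxCodeSize`, `codeSize`, `minDist`, `hammingBall`, `hammingGraph` — nothing); the tree's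
`Coding/DualDistance.lean` has `minDist` for LINEAR codes only.

## References

* J. H. van Lint, *Introduction to Coding Theory*, 2nd ed., GTM 86, Springer 1992: Def. 5.1.1,
  Thm. 5.1.3, Thm. 5.2.1 (Singleton), Def. 3.2.7 (extended code). Held
  (`lit read book:van-lint1992-introduction-coding-theory`, PDF pp. 87–88, 118–123).
* M. Laurent, *Strengthened semidefinite programming bounds for codes*, Math. Program. 109
  (2007) 239–261, §1 p. 240 (the graph `G(n,d)`; `A(n,d) = α(G(n,d))`). Held
  (`lit read doi:10.1007/s10107-006-0030-3 --pages 1-3`).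
* P. Delsarte, *An algebraic approach to the association schemes of coding theory*, Philips
  Res. Rep. Suppl. 10 (1973) — background only.
-/

namespace Literature.InformationTheory.Coding

open Finset

/-! ### The conflict graph and `A(n,d)` -/

/-- The **conflict graph** `G(n,d)` of binary words of length `n` at distance threshold `d`: the
simple graph on `Fin n → Bool` in which two words `u ≠ v` are adjacent iff `hammingDist u v < d`
(equivalently `hammingDist u v ∈ {1, …, d-1}`). Its independent sets are exactly the binary codes
of length `n` and minimum distance at least `d` (`isIndepSet_hammingConflictGraph_iff`).
Literally `SimpleGraph.fromRel (hammingDist · · < d)`.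
[cite: Laurent2006, §1 p. 240 (the graph G(n,d))] -/
def hammingConflictGraph (n d : ℕ) : SimpleGraph (Fin n → Bool) :=
  SimpleGraph.fromRel fun u v => hammingDist u v < d

/-- **`A(n,d)`**, the maximum size of a binary code of word length `n` and minimum distance at
least `d`, i.e. the largest cardinality of a set of words of `{0,1}^n` pairwise at Hamming
distance `≥ d`; defined as the independence number of the conflict graph `G(n,d)` (Laurent 2006,
p. 240: "the parameter `A(n,d)` is equal to the stability number of the graph `G(n,d)`"). See
`isGreatest_maxCodeSize` for van Lint's form `A(n,d) = max {M | an (n,M,d) code exists}`.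
[cite: Vanlint1992, Def. 5.1.1 (graph form: Laurent2006 §1 p. 240)] -/
noncomputable def maxCodeSize (n d : ℕ) : ℕ :=
  (hammingConflictGraph n d).indepNum

/-- Adjacency in `G(n,d)` is decidable (inherited from `SimpleGraph.fromRel`). [folklore] -/
instance instDecidableRelAdjHammingConflictGraph (n d : ℕ) :
    DecidableRel (hammingConflictGraph n d).Adj := by
  unfold hammingConflictGraph; infer_instance

variable {n d e : ℕ}

/-- Adjacency in `G(n,d)`: `u ~ v ↔ u ≠ v ∧ hammingDist u v < d`. [folklore] -/
@[simp] theorem hammingConflictGraph_adj {u v : Fin n → Bool} :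
    (hammingConflictGraph n d).Adj u v ↔ u ≠ v ∧ hammingDist u v < d := by
  rw [hammingConflictGraph, SimpleGraph.fromRel_adj, hammingDist_comm v u, or_self]

/-- Unfolding: `A(n,d)` is the independence number of
`SimpleGraph.fromRel fun u v : Fin n → Bool => hammingDist u v < d` (the inline form used by
route statements); holds by `rfl`. [folklore] -/
theorem maxCodeSize_def (n d : ℕ) : maxCodeSize n d =
    (SimpleGraph.fromRel fun u v : Fin n → Bool => hammingDist u v < d).indepNum := rfl

/-- The independent sets of `G(n,d)` are exactly the sets of words pairwise at Hamming distance
`≥ d` (the codes of minimum distance at least `d`). [cite: Laurent2006, §1 p. 240] -/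
theorem isIndepSet_hammingConflictGraph_iff {C : Set (Fin n → Bool)} :
    (hammingConflictGraph n d).IsIndepSet C ↔ C.Pairwise fun u v => d ≤ hammingDist u v := by
  refine ⟨fun h u hu v hv huv => ?_, fun h u hu v hv huv hadj => ?_⟩
  · exact not_lt.1 fun hlt => h hu hv huv (hammingConflictGraph_adj.2 ⟨huv, hlt⟩)
  · exact (not_lt.2 (h hu hv huv)) (hammingConflictGraph_adj.1 hadj).2

/-- Every binary code of length `n` with minimum distance `≥ d` has at most `A(n,d)` words.
[cite: Vanlint1992, Def. 5.1.1] -/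
theorem card_le_maxCodeSize {C : Finset (Fin n → Bool)}
    (hC : (C : Set (Fin n → Bool)).Pairwise fun u v => d ≤ hammingDist u v) :
    #C ≤ maxCodeSize n d :=
  (isIndepSet_hammingConflictGraph_iff.2 hC).card_le_indepNum

/-- `A(n,d)` is attained: some binary code of length `n` and minimum distance `≥ d` (an
*optimal* code) has exactly `A(n,d)` words. [cite: Vanlint1992, Def. 5.1.1] -/
theorem exists_code_card_eq_maxCodeSize (n d : ℕ) : ∃ C : Finset (Fin n → Bool),
    (C : Set (Fin n → Bool)).Pairwise (fun u v => d ≤ hammingDist u v) ∧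
      #C = maxCodeSize n d := by
  obtain ⟨C, hC⟩ := (hammingConflictGraph n d).exists_isNIndepSet_indepNum
  exact ⟨C, isIndepSet_hammingConflictGraph_iff.1 hC.isIndepSet, hC.card_eq⟩

/-- van Lint's Definition 5.1.1 verbatim: `A(n,d) = max {M | an (n, M, d) code exists}`, i.e.
`A(n,d)` is the greatest `M` such that some `M` words of `{0,1}^n` are pairwise at Hamming
distance `≥ d`. [cite: Vanlint1992, Def. 5.1.1] -/
theorem isGreatest_maxCodeSize (n d : ℕ) :
    IsGreatest {M | ∃ C : Finset (Fin n → Bool),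
      (C : Set (Fin n → Bool)).Pairwise (fun u v => d ≤ hammingDist u v) ∧ #C = M}
      (maxCodeSize n d) :=
  ⟨exists_code_card_eq_maxCodeSize n d, fun _ ⟨_, hC, hM⟩ => hM ▸ card_le_maxCodeSize hC⟩

/-! ### Comparing independence numbers along a map -/

/-- Transfer of independence numbers along a map `f : V → W` sending distinct non-adjacent
vertices of `G` to distinct non-adjacent vertices of `H` (so `f` maps every independent set of
`G` injectively onto an independent set of `H`): `α(G) ≤ α(H)`. [folklore] -/
theorem indepNum_le_indepNum_of_map {V W : Type*} [Finite W] {G : SimpleGraph V}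
    {H : SimpleGraph W} (f : V → W)
    (hf : ∀ u v, u ≠ v → ¬G.Adj u v → f u ≠ f v ∧ ¬H.Adj (f u) (f v)) :
    G.indepNum ≤ H.indepNum := by
  classical
  obtain ⟨s, hs⟩ := G.exists_isNIndepSet_indepNum
  have hinj : Set.InjOn f s := fun u hu v hv huv =>
    by_contra fun hne => (hf u v hne (hs.isIndepSet hu hv hne)).1 huv
  have hind : H.IsIndepSet (s.image f : Finset W) := by
    intro x hx y hy hxy
    rw [coe_image] at hx hy
    obtain ⟨u, hu, rfl⟩ := hx
    obtain ⟨v, hv, rfl⟩ := hy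
    have huv : u ≠ v := fun h => hxy (by rw [h])
    exact (hf u v huv (hs.isIndepSet hu hv huv)).2
  calc G.indepNum = #s := hs.card_eq.symm
    _ = #(s.image f) := (card_image_of_injOn hinj).symm
    _ ≤ H.indepNum := hind.card_le_indepNum

/-- **Transfer lemma for `A(n,d)`.** If `f` maps any two distinct words of `{0,1}^m` at distance
`≥ d` to two distinct words of `{0,1}^n` at distance `≥ e`, then `A(m,d) ≤ A(n,e)` (apply `f` to
an optimal code). Antitonicity in `d`, puncturing and extending are instances. [folklore] -/
theorem maxCodeSize_le_of_map {m n d e : ℕ} (f : (Fin m → Bool) → (Fin n → Bool))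
    (hf : ∀ u v, u ≠ v → d ≤ hammingDist u v → f u ≠ f v ∧ e ≤ hammingDist (f u) (f v)) :
    maxCodeSize m d ≤ maxCodeSize n e := by
  refine indepNum_le_indepNum_of_map f fun u v huv hadj => ?_
  rw [hammingConflictGraph_adj, not_and, not_lt] at hadj ⊢
  exact ⟨(hf u v huv (hadj huv)).1, fun _ => (hf u v huv (hadj huv)).2⟩

/-! ### Trivial values and bounds -/

/-- `A(n,d) ≤ 2^n` (a code is a set of words). [folklore] -/
theorem maxCodeSize_le_two_pow (n d : ℕ) : maxCodeSize n d ≤ 2 ^ n := by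
  obtain ⟨C, -, hC⟩ := exists_code_card_eq_maxCodeSize n d
  calc maxCodeSize n d = #C := hC.symm
    _ ≤ #(univ : Finset (Fin n → Bool)) := card_le_univ C
    _ = 2 ^ n := by rw [card_univ, Fintype.card_fun, Fintype.card_bool, Fintype.card_fin]

/-- `1 ≤ A(n,d)`: a single word is a code of every minimum distance. [folklore] -/
theorem one_le_maxCodeSize (n d : ℕ) : 1 ≤ maxCodeSize n d := by
  simpa using card_le_maxCodeSize (d := d) (C := ({fun _ : Fin n => false} : Finset _))
    (by rw [coe_singleton]; exact Set.pairwise_singleton _ _)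

/-- For `d ≤ 1` every set of words is a code, so `A(n,d) = 2^n`. [folklore] -/
theorem maxCodeSize_of_le_one (n : ℕ) (hd : d ≤ 1) : maxCodeSize n d = 2 ^ n := by
  refine le_antisymm (maxCodeSize_le_two_pow n d) ?_
  have h := card_le_maxCodeSize (d := d) (C := (univ : Finset (Fin n → Bool)))
    fun u _ v _ huv => hd.trans (Nat.one_le_iff_ne_zero.2 (hammingDist_ne_zero.2 huv))
  rwa [card_univ, Fintype.card_fun, Fintype.card_bool, Fintype.card_fin] at h

/-- `A(n,0) = 2^n`. [folklore] -/
@[simp] theorem maxCodeSize_zero_right (n : ℕ) : maxCodeSize n 0 = 2 ^ n :=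
  maxCodeSize_of_le_one n (Nat.zero_le 1)

/-- `A(n,1) = 2^n` (distinct words are at distance `≥ 1`). [folklore] -/
@[simp] theorem maxCodeSize_one_right (n : ℕ) : maxCodeSize n 1 = 2 ^ n :=
  maxCodeSize_of_le_one n le_rfl

/-- If `d > n`, no two distinct words are at distance `≥ d`, so `A(n,d) = 1`. [folklore] -/
theorem maxCodeSize_eq_one_of_lt (h : n < d) : maxCodeSize n d = 1 := by
  refine le_antisymm ?_ (one_le_maxCodeSize n d)
  obtain ⟨C, hC, hcard⟩ := exists_code_card_eq_maxCodeSize n d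
  rw [← hcard]
  by_contra! h1
  obtain ⟨u, hu, v, hv, huv⟩ := one_lt_card.1 h1
  have hle : hammingDist u v ≤ n := hammingDist_le_card_fintype.trans_eq (Fintype.card_fin n)
  exact (not_le.2 h) (((hC (mem_coe.2 hu) (mem_coe.2 hv) huv)).trans hle)

/-- `A(n,·)` is antitone: `d ≤ e → A(n,e) ≤ A(n,d)`. [folklore] -/
theorem maxCodeSize_anti (n : ℕ) (h : d ≤ e) : maxCodeSize n e ≤ maxCodeSize n d :=
  maxCodeSize_le_of_map id fun _ _ huv hd => ⟨huv, h.trans hd⟩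

/-- `A(n,·)` is antitone (bundled form). [folklore] -/
theorem antitone_maxCodeSize (n : ℕ) : Antitone (maxCodeSize n) :=
  fun _ _ h => maxCodeSize_anti n h

/-! ### One more coordinate: `Fin.cons`, puncturing, parity extension, shortening -/

/-- Hamming distance after prepending one letter: `Δ(a::u, b::v) = [a ≠ b] + Δ(u, v)`.
[folklore] -/
theorem hammingDist_cons {α : Type*} [DecidableEq α] {n : ℕ} (a b : α) (u v : Fin n → α) :
    hammingDist (Fin.cons a u : Fin (n + 1) → α) (Fin.cons b v) =
      (if a ≠ b then 1 else 0) + hammingDist u v := by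
  simp only [hammingDist]
  rw [Fin.card_filter_univ_succ']
  simp only [Fin.cons_zero, Fin.cons_succ]

/-- Hamming distance split off at coordinate `0`: `Δ(u, v) = [u 0 ≠ v 0] + Δ(tail u, tail v)`.
[folklore] -/
theorem hammingDist_eq_tail {α : Type*} [DecidableEq α] {n : ℕ} (u v : Fin (n + 1) → α) :
    hammingDist u v = (if u 0 ≠ v 0 then 1 else 0) + hammingDist (Fin.tail u) (Fin.tail v) := by
  conv_lhs => rw [← Fin.cons_self_tail u, ← Fin.cons_self_tail v]
  exact hammingDist_cons (u 0) (v 0) (Fin.tail u) (Fin.tail v)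

/-- **Puncturing**: deleting a coordinate of a code of minimum distance `≥ d + 1 ≥ 2` leaves its
words distinct and pairwise at distance `≥ d`, so `A(n+1, d+1) ≤ A(n, d)` for `d ≥ 1`.
[cite: Vanlint1992, Thm. 5.1.3 (proof, by puncturing; §5.1)] -/
theorem maxCodeSize_succ_succ_le (n : ℕ) (hd : 1 ≤ d) :
    maxCodeSize (n + 1) (d + 1) ≤ maxCodeSize n d := by
  refine maxCodeSize_le_of_map (fun u => Fin.tail u) fun u v _ hdist => ?_
  rw [hammingDist_eq_tail] at hdist
  have h : d ≤ hammingDist (Fin.tail u) (Fin.tail v) := by split_ifs at hdist <;> omega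
  exact ⟨hammingDist_pos.1 (Nat.lt_of_lt_of_le Nat.one_pos (hd.trans h)), h⟩

/-- The **overall parity bit** of a binary word: `true` iff its Hamming weight (the number of
coordinates equal to `true`) is odd. [cite: Vanlint1992, Def. 3.2.7] -/
def parityBit (u : Fin n → Bool) : Bool :=
  decide (Odd #{i | u i = true})

/-- The **extended word** `ū := (parity bit of u) :: u ∈ {0,1}^{n+1}`, of even weight; the
extended code of van Lint's Definition 3.2.7 is `{ū | u ∈ C}` (the parity symbol is prepended
here rather than appended, which is immaterial for distances). [cite: Vanlint1992, Def. 3.2.7] -/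
def parityExtend (u : Fin n → Bool) : Fin (n + 1) → Bool :=
  Fin.cons (parityBit u) u

/-- Unfolding of `parityBit`. [folklore] -/
theorem parityBit_eq (u : Fin n → Bool) : parityBit u = decide (Odd #{i | u i = true}) := rfl

/-- Unfolding of `parityExtend`: coordinate `0` is the parity bit. [folklore] -/
@[simp] theorem parityExtend_zero (u : Fin n → Bool) : parityExtend u 0 = parityBit u :=
  Fin.cons_zero _ _

/-- Unfolding of `parityExtend`: coordinate `i + 1` is `u i`. [folklore] -/
@[simp] theorem parityExtend_succ (u : Fin n → Bool) (i : Fin n) :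
    parityExtend u i.succ = u i :=
  Fin.cons_succ _ _ _

/-- `parityExtend` is injective. [folklore] -/
theorem parityExtend_injective (n : ℕ) : Function.Injective (parityExtend (n := n)) :=
  fun _ _ h => (Fin.cons_injective2 h).2

/-- Distance versus weights: `Δ(u,v) + 2·#{i | uᵢ = vᵢ = 1} = wt(u) + wt(v)`; in particular
`Δ(u,v) ≡ wt(u) + wt(v) (mod 2)`. [folklore] -/
theorem hammingDist_add_two_mul_card {ι : Type*} [Fintype ι] (u v : ι → Bool) :
    hammingDist u v + 2 * #{i | u i = true ∧ v i = true} =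
      #{i | u i = true} + #{i | v i = true} := by
  simp only [hammingDist, card_filter, mul_sum, ← sum_add_distrib]
  refine sum_congr rfl fun i _ => ?_
  cases u i <;> cases v i <;> simp

/-- Words at odd Hamming distance have different parity bits (equivalently: words of equal
parity are at even distance — "all distances in the extended code are even").
[cite: Vanlint1992, Def. 3.2.7 (remark following it)] -/
theorem parityBit_ne_of_odd_hammingDist {u v : Fin n → Bool} (h : Odd (hammingDist u v)) :
    parityBit u ≠ parityBit v := by
  intro hp
  simp only [parityBit, decide_eq_decide] at hp
  have h1 : Odd (hammingDist u v + 2 * #{i | u i = true ∧ v i = true}) :=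
    h.add_even (even_two_mul _)
  rw [hammingDist_add_two_mul_card, Nat.odd_add] at h1
  by_cases hv : Odd #{i | v i = true}
  · exact (Nat.not_even_iff_odd.2 hv) (h1.1 (hp.2 hv))
  · exact hv (hp.1 (h1.2 (Nat.not_odd_iff_even.1 hv)))

/-- Distance of extended words: `Δ(ū, v̄) = [parity bits differ] + Δ(u, v)`. [folklore] -/
theorem hammingDist_parityExtend (u v : Fin n → Bool) :
    hammingDist (parityExtend u) (parityExtend v) =
      (if parityBit u ≠ parityBit v then 1 else 0) + hammingDist u v :=
  hammingDist_cons _ _ _ _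

/-- **Extending by a parity check**: for odd `d`, distinct words at distance `≥ d` extend to
distinct words at distance `≥ d + 1` (a distance equal to `d` is odd, so the parity bits differ),
hence `A(n, d) ≤ A(n+1, d+1)`. [cite: Vanlint1992, Thm. 5.1.3 (proof, with Def. 3.2.7)] -/
theorem maxCodeSize_le_succ_succ_of_odd (n : ℕ) (hd : Odd d) :
    maxCodeSize n d ≤ maxCodeSize (n + 1) (d + 1) := by
  refine maxCodeSize_le_of_map parityExtend fun u v huv hdist =>
    ⟨(parityExtend_injective n).ne huv, ?_⟩
  rw [hammingDist_parityExtend]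
  rcases hdist.eq_or_lt with heq | hlt
  · rw [if_pos (parityBit_ne_of_odd_hammingDist (heq ▸ hd))]
    omega
  · split_ifs <;> omega

/-- **van Lint's Theorem 5.1.3** (binary codes): `A(n+1, d+1) = A(n, d)` for odd `d`, i.e.
`A(n, 2l-1) = A(n+1, 2l)` — puncture one way, extend by a parity bit the other way.
[cite: Vanlint1992, Thm. 5.1.3] -/
theorem maxCodeSize_succ_succ_of_odd (n : ℕ) (hd : Odd d) :
    maxCodeSize (n + 1) (d + 1) = maxCodeSize n d :=
  le_antisymm (maxCodeSize_succ_succ_le n (Nat.one_le_iff_ne_zero.2 hd.pos.ne'))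
    (maxCodeSize_le_succ_succ_of_odd n hd)

/-- `A(n+1, 2) = 2^n`: by Theorem 5.1.3 with `d = 1` (the even-weight code of length `n + 1` is
optimal for `d = 2`). [cite: Vanlint1992, Thm. 5.1.3 (with A(n,1) = 2^n)] -/
theorem maxCodeSize_succ_two (n : ℕ) : maxCodeSize (n + 1) 2 = 2 ^ n := by
  rw [maxCodeSize_succ_succ_of_odd n odd_one, maxCodeSize_one_right]

/-- **Shortening**: splitting an optimal code of length `n + 1` by its first letter and deleting
that letter gives two codes of length `n` with the same minimum distance, so
`A(n+1, d) ≤ 2·A(n, d)`.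
[cite: Vanlint1992, §5.1–5.2 (shortening; Example (a) after Thm. 5.2.4: M' ≥ 2^{-k} M)] -/
theorem maxCodeSize_succ_le_two_mul (n d : ℕ) :
    maxCodeSize (n + 1) d ≤ 2 * maxCodeSize n d := by
  obtain ⟨C, hC, hcard⟩ := exists_code_card_eq_maxCodeSize (n + 1) d
  have half : ∀ b : Bool, #(C.filter fun u => u 0 = b) ≤ maxCodeSize n d := fun b => by
    rw [← card_image_of_injOn (f := fun u : Fin (n + 1) → Bool => Fin.tail u)]
    · refine card_le_maxCodeSize fun x hx y hy hxy => ?_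
      rw [coe_image] at hx hy
      obtain ⟨u, hu, rfl⟩ := hx
      obtain ⟨v, hv, rfl⟩ := hy
      rw [mem_coe, mem_filter] at hu hv
      have huv : u ≠ v := fun h => hxy (by rw [h])
      have h : d ≤ hammingDist u v := hC (mem_coe.2 hu.1) (mem_coe.2 hv.1) huv
      rw [hammingDist_eq_tail, if_neg (fun hne => hne (hu.2.trans hv.2.symm)), zero_add] at h
      exact h
    · intro u hu v hv huv
      rw [mem_coe, mem_filter] at hu hv
      funext i
      refine Fin.cases ?_ (fun j => ?_) i
      · exact hu.2.trans hv.2.symm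
      · exact congr_fun huv j
  calc maxCodeSize (n + 1) d = #C := hcard.symm
    _ = #(C.filter fun u => u 0 = true) + #(C.filter fun u => ¬u 0 = true) :=
        (card_filter_add_card_filter_not _).symm
    _ ≤ maxCodeSize n d + maxCodeSize n d := add_le_add (half true) (by simpa using half false)
    _ = 2 * maxCodeSize n d := (two_mul _).symm

/-- **Singleton bound** (binary): `A(n, d) ≤ 2^(n+1-d)` — puncture `d - 1` times
(`maxCodeSize_succ_succ_le`) down to `A(n+1-d, 1) = 2^(n+1-d)`. Stated with truncated
subtraction: for `1 ≤ d ≤ n + 1` this is van Lint's `A(n,d) ≤ q^{n-d+1}` at `q = 2`; for `d = 0`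
or `d > n + 1` it is implied by the trivial bounds. [cite: Vanlint1992, Thm. 5.2.1] -/
theorem maxCodeSize_le_two_pow_sub (n d : ℕ) : maxCodeSize n d ≤ 2 ^ (n + 1 - d) := by
  induction d generalizing n with
  | zero => exact (maxCodeSize_le_two_pow n 0).trans (Nat.pow_le_pow_right two_pos (by omega))
  | succ d ih =>
    rcases d.eq_zero_or_pos with rfl | hd
    · simp
    · cases n with
      | zero => rw [maxCodeSize_eq_one_of_lt (by omega)]; exact Nat.one_le_two_pow
      | succ n =>
        exact (maxCodeSize_succ_succ_le n hd).trans
          ((ih n).trans_eq (congrArg (2 ^ ·) (by omega)))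

/-- `A(n, n) = 2` for `n ≥ 1`: a word and its complement (upper bound: Singleton).
[folklore] -/
theorem maxCodeSize_self_of_pos (hn : 0 < n) : maxCodeSize n n = 2 := by
  refine le_antisymm ((maxCodeSize_le_two_pow_sub n n).trans_eq ?_) ?_
  · rw [show n + 1 - n = 1 by omega, pow_one]
  · have hne : (fun _ : Fin n => false) ≠ fun _ => true :=
      fun h => Bool.false_ne_true (congr_fun h ⟨0, hn⟩)
    have hdist : hammingDist (fun _ : Fin n => false) (fun _ => true) = n := by
      simp [hammingDist]
    have h := card_le_maxCodeSize (d := n)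
      (C := ({fun _ => false, fun _ => true} : Finset (Fin n → Bool))) ?_
    · rwa [card_pair hne] at h
    · rw [coe_pair, Set.pairwise_pair]
      exact fun _ => ⟨hdist.ge, hdist.ge.trans_eq (hammingDist_comm _ _)⟩

end Literature.InformationTheory.Coding
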